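import Mathlib
import Literature.Analysis.ODE.VolterraRecessive
import Literature.Analysis.PDE.Wave1DExteriorEnergy
import Summits.FinalStateConjecture.FinalStateConjecture.Theorems.PhotonSphereChannelsTails

/-!
# Route PhotonSphereChannels — near-channel estimate: constants, the static kernel element, time reversal

Helper file for the horizon-side (near) half-line channel estimate of `FixedModeChannels`
(stmt-FinalStateConjecture-10048), assembled in `PhotonSphereChannelsNearChannels.lean`:

* `near_smallness` — the choice `ρ₀ = max 0 (2M log(25600 M² B e^{3/2M}))` makes the master small
  quantity `4M²B e^{3/2M} e^{−ρ/2M} ≤ 1/6400` for `ρ ≥ ρ₀` (it dominates the Volterra contraction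
  constant, the Hardy constant and `σ²/4` of the Duhamel step);
* static solutions: a global classical solution `U` of `U'' = VU` (`IsSchrodingerSol V U`,
  `Literature/Analysis/ODE/SchrodingerODE`) is `C²`; `(t, x) ↦ βU(x)` is a `C²` solution of the wave
  equation `ψ_tt − ψ_xx + Vψ = 0` in the route's `iteratedDeriv` form (a t-polynomial of degree 0 —
  the kernel element), and `ψ − βU` is again a global `C²` solution;
* `liminf_neg_atTop` — `liminf_{t→+∞} u(−t) = liminf_{t→−∞} u`;
* `integrableOn_of_lintegral_lt_top` — a continuous non-negative density with finite lower integral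
  on `(−∞, a)` is integrable on `(−∞, a]`, with `ofReal ∫ = ∫⁻`.
-/

noncomputable section

namespace Summit.FinalStateConjecture.FinalStateConjecture.Theorems

open Literature.Analysis.ODE MeasureTheory Real Set Filter Topology

/-! ### The master smallness constant -/

/-- **Choice of the excision radius.** For `M, B > 0` and
`ρ ≥ max 0 (2M · log(25600 M² B e^{3/(2M)}))`: `4M²B e^{3/(2M)} e^{−ρ/(2M)} ≤ 1/6400`. -/
theorem near_smallness {M B ρ : ℝ} (hM : 0 < M) (hB : 0 < B)
    (hρ : max 0 (2 * M * Real.log (25600 * M ^ 2 * B * exp (3 / (2 * M)))) ≤ ρ) :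
    4 * M ^ 2 * B * exp (3 / (2 * M)) * exp (-ρ / (2 * M)) ≤ 1 / 6400 := by
  set C : ℝ := 25600 * M ^ 2 * B * exp (3 / (2 * M)) with hC
  have hC0 : 0 < C := by positivity
  have h2M : 0 < 2 * M := by positivity
  have hρ0 : 0 ≤ ρ := (le_max_left _ _).trans hρ
  have hkey : 4 * M ^ 2 * B * exp (3 / (2 * M)) = C / 6400 := by simp only [hC]; ring
  rw [hkey]
  rcases le_or_gt 1 C with hC1 | hC1
  · -- `ρ ≥ 2M log C`, so `e^{-ρ/2M} ≤ 1/C`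
    have hlog : 2 * M * Real.log C ≤ ρ := (le_max_right _ _).trans hρ
    have hexp : exp (-ρ / (2 * M)) ≤ C⁻¹ := by
      have : C⁻¹ = exp (-Real.log C) := by rw [Real.exp_neg, Real.exp_log hC0]
      rw [this]
      refine exp_le_exp.2 ?_
      rw [neg_div, neg_le_neg_iff, le_div_iff₀ h2M]
      linarith
    calc C / 6400 * exp (-ρ / (2 * M)) ≤ C / 6400 * C⁻¹ :=
          mul_le_mul_of_nonneg_left hexp (by positivity)
      _ = 1 / 6400 := by field_simp
  · have hexp : exp (-ρ / (2 * M)) ≤ 1 := by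
      rw [exp_le_one_iff, neg_div]; exact neg_nonpos.2 (div_nonneg hρ0 h2M.le)
    calc C / 6400 * exp (-ρ / (2 * M)) ≤ C / 6400 * 1 :=
          mul_le_mul_of_nonneg_left hexp (by positivity)
      _ ≤ 1 / 6400 := by nlinarith

/-! ### Static (t-independent) solutions -/

section Static

variable {V U : ℝ → ℝ}

/-- A global classical solution of `U'' = V U` with continuous `V` is `C²`. -/
theorem contDiff_two_of_isSchrodingerSol (hU : IsSchrodingerSol V U) (hV : Continuous V) :
    ContDiff ℝ 2 U := by
  rw [show (2 : WithTop ℕ∞) = (1 : WithTop ℕ∞) + 1 by norm_num, contDiff_succ_iff_deriv]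
  refine ⟨hU.differentiable, fun h => absurd h (by simp), ?_⟩
  rw [show (1 : WithTop ℕ∞) = 0 + 1 by norm_num, contDiff_succ_iff_deriv]
  refine ⟨hU.differentiable_deriv, fun h => absurd h (by simp), ?_⟩
  have : deriv (deriv U) = fun s => V s * U s := funext hU.deriv_deriv
  rw [this]
  exact contDiff_zero.2 (hV.mul hU.continuous)

/-- `iteratedDeriv 2 U = V · U` for a global classical solution. -/
theorem iteratedDeriv_two_of_isSchrodingerSol (hU : IsSchrodingerSol V U) (x : ℝ) :
    iteratedDeriv 2 U x = V x * U x := by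
  rw [iteratedDeriv_succ, iteratedDeriv_one]
  exact hU.deriv_deriv x

/-- **The static kernel element.** For a global solution `U` of `U'' = VU` (`V` continuous) and
`β : ℝ`, the t-independent function `(t, x) ↦ β U(x)` is a global `C²` solution of
`ψ_tt − ψ_xx + V ψ = 0` in the `iteratedDeriv` form of the route's items. -/
theorem static_isSol (hU : IsSchrodingerSol V U) (hV : Continuous V) (β : ℝ) :
    ContDiff ℝ 2 (Function.uncurry fun (_ : ℝ) (x : ℝ) => β * U x) ∧
      ∀ t x : ℝ, iteratedDeriv 2 (fun _ : ℝ => β * U x) t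
        - iteratedDeriv 2 (fun y => β * U y) x + V x * (β * U x) = 0 := by
  have hUC2 := contDiff_two_of_isSchrodingerSol hU hV
  refine ⟨?_, fun t x => ?_⟩
  · exact contDiff_const.mul (hUC2.comp contDiff_snd)
  · rw [iteratedDeriv_const, iteratedDeriv_const_mul_field,
      iteratedDeriv_two_of_isSchrodingerSol hU]
    simp only [OfNat.ofNat_ne_zero, ↓reduceIte]
    ring

/-- **Subtracting a static solution.** If `ψ` is a global `C²` solution of `ψ_tt − ψ_xx + Vψ = 0`
and `U'' = VU` globally, then `φ = ψ − βU` is again a global `C²` solution. -/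
theorem sub_static_isSol {ψ : ℝ → ℝ → ℝ} (hψ : ContDiff ℝ 2 (Function.uncurry ψ))
    (hsol : ∀ t x, iteratedDeriv 2 (fun τ => ψ τ x) t - iteratedDeriv 2 (ψ t) x + V x * ψ t x = 0)
    (hU : IsSchrodingerSol V U) (hV : Continuous V) (β : ℝ) :
    ContDiff ℝ 2 (Function.uncurry fun t x => ψ t x - β * U x) ∧
      ∀ t x : ℝ, iteratedDeriv 2 (fun τ => ψ τ x - β * U x) t
        - iteratedDeriv 2 (fun y => ψ t y - β * U y) x + V x * (ψ t x - β * U x) = 0 := by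
  obtain ⟨hsC2, hs⟩ := static_isSol hU hV β
  refine ⟨hψ.sub hsC2, fun t x => ?_⟩
  have hUC2 := contDiff_two_of_isSchrodingerSol hU hV
  have c1 : ContDiff ℝ 2 fun τ => ψ τ x := hψ.comp (contDiff_id.prodMk contDiff_const)
  have c2 : ContDiff ℝ 2 (ψ t) := hψ.comp (contDiff_const.prodMk contDiff_id)
  have c3 : ContDiff ℝ 2 fun _ : ℝ => β * U x := contDiff_const
  have c4 : ContDiff ℝ 2 fun y => β * U y := contDiff_const.mul hUC2
  rw [iteratedDeriv_fun_sub (n := 2) c1.contDiffAt c3.contDiffAt,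
    iteratedDeriv_fun_sub (n := 2) c2.contDiffAt c4.contDiffAt]
  have e1 := hsol t x
  have e2 := hs t x
  linarith

end Static

/-! ### Time reversal of `liminf`, and densities with finite lower integral -/

/-- `liminf_{t → +∞} u(−t) = liminf_{t → −∞} u`. -/
theorem liminf_neg_atTop {α : Type*} [ConditionallyCompleteLattice α] (u : ℝ → α) :
    liminf (fun t => u (-t)) atTop = liminf u atBot := by
  rw [show (fun t => u (-t)) = u ∘ Neg.neg from rfl, Filter.liminf_comp, Filter.map_neg_atTop]

/-- A continuous non-negative function with finite lower integral on `(−∞, a)` is integrable on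
`(−∞, a]`, and `ofReal (∫_{Iic a} f) = ∫⁻_{Iio a} ofReal f`. -/
theorem integrableOn_of_lintegral_lt_top {f : ℝ → ℝ} (hf : Continuous f) (hf0 : ∀ x, 0 ≤ f x)
    {a : ℝ} (hfin : ∫⁻ x in Iio a, ENNReal.ofReal (f x) < ⊤) :
    IntegrableOn f (Iic a) ∧ ENNReal.ofReal (∫ x in Iic a, f x) = ∫⁻ x in Iio a, ENNReal.ofReal (f x) := by
  have hfin' : ∫⁻ x in Iic a, ENNReal.ofReal (f x) < ⊤ := by
    rwa [← setLIntegral_congr (Iio_ae_eq_Iic (μ := volume) (a := a))]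
  have hint : IntegrableOn f (Iic a) :=
    ⟨hf.aestronglyMeasurable, (hasFiniteIntegral_iff_ofReal (ae_of_all _ hf0)).2 hfin'⟩
  refine ⟨hint, ?_⟩
  rw [ofReal_integral_eq_lintegral_ofReal hint (ae_of_all _ hf0),
    setLIntegral_congr (Iio_ae_eq_Iic (μ := volume) (a := a))]

end Summit.FinalStateConjecture.FinalStateConjecture.Theorems
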